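import Literature.AlgebraicGeometry.Resolution.ProjectiveResolutionIsoOverRegularLocus
import Literature.AlgebraicGeometry.Resolution.MinimalResolutionLiftsAutomorphisms
import Literature.AlgebraicGeometry.Resolution.MinimalResolutionIsoOverRegularLocus
import HarnessLib

/-!
# Kollár's lifting fact holds at every projective variety admitting a projective minimal resolution (Kollár 2007, Thm. 3.36 + §3.4.1; Bădescu 2001, Prop. 4.5)

Topic: `Literature/AlgebraicGeometry/Resolution`. Theorems only (no named fact, no definition).

Assembly of three tree files: for an integral projective `X` over a field of characteristic zero,
* some projective resolution is an isomorphism over the regular locus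
  (`exists_isResolution_isProjectiveOver_isIso_regularLocus`, Kollár 3.36 (1)(2));
* hence a MINIMAL resolution `r : Y → X` (universal property, `IsMinimalResolution`) is an
  isomorphism over the regular locus (`IsMinimalResolution.isIso_morphismRestrict_of_regular`);
* and every automorphism ∕ group action on `X` lifts to it (`IsMinimalResolution.liftClause`,
  `IsMinimalResolution.exists_actionOver`, Kollár §3.4.1 with functoriality supplied by minimality).
So the conclusion of the named fact `Kollar2007_resolutionLiftsAutomorphisms`
(`FunctorialResolutionAutomorphisms.lean`) holds AT `X` as soon as `X` has a minimal resolution with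
projective source — with no functoriality of the resolution algorithm. Intended consumer: the
normal projective `Q₈`-surface `N` of `HodgeTheory/QuaternionicQuarticGenericModel.lean`
(`Q8Family.exists_genericModel`), once the existence of minimal desingularizations of normal surfaces
(Bădescu Thm. 4.3 ∕ Lipman 1969) is in the tree.

## References

* [Kollar2007] J. Kollár, Lectures on Resolution of Singularities (2007), Thm. 3.36, §3.4.1 (p. 121).
* [Badescu2001] L. Bădescu, Algebraic Surfaces (2001), Def. 4.4, Prop. 4.5.
-/

noncomputable section

open CategoryTheory AlgebraicGeometry

namespace Literature.AlgebraicGeometry.Resolution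

universe u

open Literature.AlgebraicGeometry.Motives Literature.AlgebraicGeometry.RelativeSpec

/-- **The conclusion of `Kollar2007_resolutionLiftsAutomorphisms` at an `X` with a projective
minimal resolution.** For an integral projective `X` over a field `k` of characteristic zero and a
minimal resolution `r : Y → X` with `Y` projective over `k`: `r` is a resolution, `Y` is projective,
`r` is an isomorphism over every open of regular points, and every `k`-automorphism of `X` lifts
along `r`. [cite: Kollar2007, Thm. 3.36 (1)(2)(4) and §3.4.1 (p. 121)] [cite: Badescu2001, Prop. 4.5] -/
theorem kollar336_conclusion_of_isMinimalResolution_of_isProjectiveOver {k : Type u} [Field k]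
    [CharZero k] (X : SchemeOver k) [IsIntegral X.left] (hX : IsProjectiveOver X)
    {Y : Scheme.{u}} {r : Y ⟶ X.left} (h : IsMinimalResolution r)
    (hproj : IsProjectiveOver (Over.mk (r ≫ X.hom))) :
    ∃ (Y : Scheme.{u}) (r : Y ⟶ X.left), IsResolution r ∧ IsProjectiveOver (Over.mk (r ≫ X.hom)) ∧
      (∀ U : X.left.Opens, (∀ x ∈ U, IsRegularLocalRing (X.left.presheaf.stalk x)) → IsIso (r ∣_ U)) ∧
      ∀ e : X.left ≅ X.left, e.hom ≫ X.hom = X.hom → ∃ e' : Y ⟶ Y, e' ≫ r = r ≫ e.hom := by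
  obtain ⟨Y₀, r₀, hr₀, -, hreg₀⟩ := exists_isResolution_isProjectiveOver_isIso_regularLocus X hX
  exact kollar336_conclusion_of_isMinimalResolution X h hproj
    (h.isIso_morphismRestrict_of_regular hr₀ hreg₀)

/-- The same with a group action (the shape of
`Kollar2007_resolutionLiftsAutomorphisms.exists_actionOver`, without the named fact): an action of a
group `G` on `X` over `k` lifts to the projective minimal resolution, equivariantly.
[cite: Kollar2007, Thm. 3.36 and §3.4.1 (p. 121)] [cite: Badescu2001, Prop. 4.5] -/
theorem exists_actionOver_of_isMinimalResolution_of_isProjectiveOver {k : Type u} [Field k]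
    [CharZero k] (X : SchemeOver k) [IsIntegral X.left] (hX : IsProjectiveOver X)
    {Y : Scheme.{u}} {r : Y ⟶ X.left} (h : IsMinimalResolution r)
    (hproj : IsProjectiveOver (Over.mk (r ≫ X.hom))) {G : Type*} [Group G] (ρ : ActionOver X.hom G) :
    ∃ (Y : Scheme.{u}) (r : Y ⟶ X.left) (ρY : ActionOver (r ≫ X.hom) G), IsResolution r ∧
      IsProjectiveOver (Over.mk (r ≫ X.hom)) ∧
      (∀ U : X.left.Opens, (∀ x ∈ U, IsRegularLocalRing (X.left.presheaf.stalk x)) → IsIso (r ∣_ U)) ∧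
      ∀ g : G, (ρY.aut g).hom ≫ r = r ≫ (ρ.aut g).hom := by
  obtain ⟨Y₀, r₀, hr₀, -, hreg₀⟩ := exists_isResolution_isProjectiveOver_isIso_regularLocus X hX
  exact exists_actionOver_of_isMinimalResolution X h hproj
    (h.isIso_morphismRestrict_of_regular hr₀ hreg₀) ρ

/-- **`Kollar2007_resolutionLiftsAutomorphisms` from minimal resolutions**: if every integral
projective variety over every field of characteristic zero admits a minimal resolution (universal
property) with projective source, the named fact holds. (A reduction only: the hypothesis is known
for surfaces — Bădescu Thm. 4.3 — and fails to be the right tool in higher dimension, where minimal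
resolutions need not exist.) [cite: Kollar2007, Thm. 3.36 and §3.4.1 (p. 121)] [cite: Badescu2001, Prop. 4.5] -/
theorem Kollar2007_resolutionLiftsAutomorphisms_of_exists_isMinimalResolution
    (H : ∀ (k : Type u) [Field k] [CharZero k] (X : SchemeOver k) [IsIntegral X.left],
      IsProjectiveOver X → ∃ (Y : Scheme.{u}) (r : Y ⟶ X.left), IsMinimalResolution r ∧
        IsProjectiveOver (Over.mk (r ≫ X.hom))) :
    Kollar2007_resolutionLiftsAutomorphisms.{u} := by
  intro k _ _ X _ hX
  obtain ⟨Y, r, h, hproj⟩ := H k X hX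
  exact kollar336_conclusion_of_isMinimalResolution_of_isProjectiveOver X hX h hproj

end Literature.AlgebraicGeometry.Resolution

end
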